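import Literature.Probability.Percolation.QuadCrossingSpace
import HarnessLib

/-!
# Crossing events of fixed quads are continuity events of subsequential limits (SS11, Lemma 5.1)

Topic `Probability/Percolation`, companion of `QuadCrossingSpace.lean` (the Schramm–Smirnov space
`ℋ_D = QuadConfig D` with the topology `𝒯_D`, the crossing events `⊞_Q = crossedEvent Q`, the laws
`μ_δ = squareCrossingLaw D δ` of critical bond percolation on `δℤ²`, and the subsequential scaling
limits `IsSubseqQuadLimit D μ`).

**Source (held, read: arXiv:1101.5820, §5 and §6).** O. Schramm, S. Smirnov, *On the scaling
limits of planar percolation*, Ann. Probab. 39 (2011) 1768–1814: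

* **Lemma 5.1.** "Let `μ₀` be some subsequential scaling limit, then the boundary (in topology
  `𝒯` on `ℋ`) of a crossing event has probability zero.  Namely, `μ₀(∂⊞_{Q₀}) = 0` holds for every
  `Q₀ ∈ 𝒬_D`."  (Proof: perturbations `Q' < Q₀ < Q''` of `Q₀` inside `D`, the continuity
  Lemma 6.1 — an RSW estimate, Assumptions 1.1 (1) — and the portmanteau theorem.)
* **Corollary 5.2.** "If `𝓜 ⊂ ℋ_D` is in the Boolean algebra generated by finitely many of the
  events `⊞_Q`, `Q ∈ 𝒬_D` …, then `μ₀(𝓜) = lim_{|η|→0} μ_η(𝓜)`" (along the subsequence; from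
  Lemma 5.1 and portmanteau).
* Scope (p. 7): "we study collections of percolation models satisfying Assumptions 1.1.  In
  particular, our results apply to critical and near-critical site percolation on the triangular
  lattice and bond percolation on the square lattice."

**Contents.**

* `SchrammSmirnov2011_lemma_5_1` — the one NAMED FACT of this file: for `D ⊆ ℂ` open nonempty,
  every subsequential scaling limit `μ` of critical bond percolation on `δℤ²` in `ℋ_D`
  (`IsSubseqQuadLimit D μ`, the tree's notion; a special case of the printed "some subsequential
  scaling limit" of a model satisfying Assumptions 1.1) gives the topological boundary of every
  crossing event measure zero: `μ (frontier ⊞_Q) = 0` for all `Q ∈ 𝒬_D`.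
* PROVED, generic (any measure on any topological space): the events with `μ`-null boundary form a
  Boolean algebra — `measure_frontier_compl_eq_zero`, `…_union_…`, `…_inter_…`, and the `Finset`
  versions; hence (`SchrammSmirnov2011_lemma_5_1.measure_frontier_cylinderAtom_eq_zero`,
  `….measure_frontier_dnf_eq_zero`) every finite intersection of crossing events and complements
  of crossing events, and every finite union of such atoms — i.e. every event of the Boolean
  algebra generated by finitely many `⊞_Q`, in disjunctive normal form — is a `μ`-continuity set.
  This is the hypothesis of the portmanteau step of Cor. 5.2; the convergence
  `μ_{δₖ}(𝓜) → μ(𝓜)` itself is Mathlib's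
  `MeasureTheory.ProbabilityMeasure.tendsto_measure_of_null_frontier_of_tendsto` once the laws are
  known to be probability measures on the metrisable space `(ℋ_D, 𝒯_D)` (Thm. 1.4 (1),
  `SchrammSmirnov2011_thm_1_4`, and measurability of `configOf`, both recorded in
  `QuadCrossingSpace.lean`), and is not restated as a fact here.

Not here: the analogue for the image of the lattice under a fixed plane homeomorphism/`C¹`
diffeomorphism `g` (route `CardyBlackNoise`): it FOLLOWS from the straight case in the pulled-back
domain, since `QuadConfig.mapHomeomorph g` carries `⊞_Q` to `⊞_{g ∘ Q}`, boundaries to boundaries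
and weak limits to weak limits — to be assembled by the route once the bent laws are defined as
these push-forwards.

## References

* O. Schramm, S. Smirnov, Ann. Probab. 39 (2011) 1768–1814, arXiv:1101.5820: Lemma 5.1,
  Cor. 5.2 (§5, p. 21 of the arXiv version), Lemma 6.1 (§6), Assumptions 1.1 and p. 7.
  [SchrammSmirnov2011]
* R. M. Dudley, *Real Analysis and Probability*, Thm. 11.1.1 (portmanteau), as cited loc. cit.
-/

noncomputable section

open Set Filter MeasureTheory
open scoped Topology

namespace Literature.Probability.Percolation

namespace QuadCrossing

/-! ### Events with null boundary form a Boolean algebra (generic) -/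

section NullFrontier

variable {Ω : Type*} [TopologicalSpace Ω] [MeasurableSpace Ω] (μ : Measure Ω)

/-- The complement of a `μ`-continuity set is a `μ`-continuity set (`∂(Aᶜ) = ∂A`). [folklore] -/
theorem measure_frontier_compl_eq_zero {A : Set Ω} (h : μ (frontier A) = 0) :
    μ (frontier Aᶜ) = 0 := by
  rwa [frontier_compl]

/-- A union of two `μ`-continuity sets is a `μ`-continuity set (`∂(A ∪ B) ⊆ ∂A ∪ ∂B`). [folklore] -/
theorem measure_frontier_union_eq_zero {A B : Set Ω} (hA : μ (frontier A) = 0)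
    (hB : μ (frontier B) = 0) : μ (frontier (A ∪ B)) = 0 :=
  measure_mono_null (frontier_union_subset A B)
    (measure_union_null (measure_mono_null inter_subset_left hA)
      (measure_mono_null inter_subset_right hB))

/-- An intersection of two `μ`-continuity sets is a `μ`-continuity set (`∂(A ∩ B) ⊆ ∂A ∪ ∂B`).
[folklore] -/
theorem measure_frontier_inter_eq_zero {A B : Set Ω} (hA : μ (frontier A) = 0)
    (hB : μ (frontier B) = 0) : μ (frontier (A ∩ B)) = 0 :=
  measure_mono_null (frontier_inter_subset A B)
    (measure_union_null (measure_mono_null inter_subset_left hA)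
      (measure_mono_null inter_subset_right hB))

/-- A finite union of `μ`-continuity sets is a `μ`-continuity set. [folklore] -/
theorem measure_frontier_biUnion_finset_eq_zero {ι : Type*} (s : Finset ι) {A : ι → Set Ω}
    (h : ∀ i ∈ s, μ (frontier (A i)) = 0) : μ (frontier (⋃ i ∈ s, A i)) = 0 := by
  classical
  induction s using Finset.induction_on with
  | empty => simp
  | insert a s ha ih =>
    rw [Finset.set_biUnion_insert]
    exact measure_frontier_union_eq_zero μ (h a (Finset.mem_insert_self a s))
      (ih fun i hi => h i (Finset.mem_insert_of_mem hi))

/-- A finite intersection of `μ`-continuity sets is a `μ`-continuity set. [folklore] -/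
theorem measure_frontier_biInter_finset_eq_zero {ι : Type*} (s : Finset ι) {A : ι → Set Ω}
    (h : ∀ i ∈ s, μ (frontier (A i)) = 0) : μ (frontier (⋂ i ∈ s, A i)) = 0 := by
  classical
  induction s using Finset.induction_on with
  | empty => simp
  | insert a s ha ih =>
    rw [Finset.set_biInter_insert]
    exact measure_frontier_inter_eq_zero μ (h a (Finset.mem_insert_self a s))
      (ih fun i hi => h i (Finset.mem_insert_of_mem hi))

end NullFrontier

/-! ### The named fact: Lemma 5.1 -/

/-- **Schramm–Smirnov 2011, Lemma 5.1** ("the boundary of a crossing event has probability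
zero").  Printed: "Let `μ₀` be some subsequential scaling limit, then the boundary (in topology
`𝒯` on `ℋ`) of a crossing event has probability zero.  Namely, `μ₀(∂⊞_{Q₀}) = 0` holds for every
`Q₀ ∈ 𝒬_D`" — for percolation models satisfying Assumptions 1.1, "in particular … bond
percolation on the square lattice" (p. 7).  Tree rendering, for `D ⊆ ℂ` open and nonempty: every
subsequential scaling limit `μ` of the laws `μ_δ` of critical bond percolation on `δℤ²` in the
Schramm–Smirnov space `ℋ_D` (`IsSubseqQuadLimit D μ`: weak limit of `squareCrossingLaw D δₖ`
along some `δₖ → 0⁺`) gives the topological boundary (Mathlib `frontier`, in `𝒯_D`) of the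
crossing event `⊞_Q = crossedEvent Q` of EVERY quad `Q ∈ 𝒬_D` measure zero.  Named fact
(D-0014), not proved here (the printed proof: RSW continuity Lemma 6.1 + portmanteau).
[cite: SchrammSmirnov2011, Lemma 5.1] -/
def SchrammSmirnov2011_lemma_5_1 : Prop :=
  ∀ (D : Set ℂ), IsOpen D → D.Nonempty →
    ∀ μ : FiniteMeasure (QuadConfig D), IsSubseqQuadLimit D μ →
      ∀ Q : Quad D, (μ : Measure (QuadConfig D)) (frontier (QuadConfig.crossedEvent Q)) = 0

/-! ### Consequences: the Boolean algebra of finitely many crossing events (Cor. 5.2, hypothesis) -/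

section Consequences

variable {D : Set ℂ} {μ : FiniteMeasure (QuadConfig D)}

/-- Complements of crossing events (`V^Q = ¬⊞_Q`) are continuity events of every subsequential
limit. [cite: SchrammSmirnov2011, Lemma 5.1] -/
theorem SchrammSmirnov2011_lemma_5_1.measure_frontier_notCrossed_eq_zero
    (h : SchrammSmirnov2011_lemma_5_1) (hD : IsOpen D) (hne : D.Nonempty)
    (hμ : IsSubseqQuadLimit D μ) (Q : Quad D) :
    (μ : Measure (QuadConfig D)) (frontier (QuadConfig.notCrossed Q)) = 0 := by
  rw [← QuadConfig.compl_crossedEvent]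
  exact measure_frontier_compl_eq_zero _ (h D hD hne μ hμ Q)

/-- **Atoms of the Boolean algebra of crossing events are continuity events**: a finite
intersection of crossing events `⊞_{Q i}` (`pos i = true`) and complements `¬⊞_{Q i}`
(`pos i = false`) has `μ`-null boundary for every subsequential limit `μ`.
[cite: SchrammSmirnov2011, Cor. 5.2 (proof: "Lemma 5.1 implies μ₀(∂𝓜) = 0")] -/
theorem SchrammSmirnov2011_lemma_5_1.measure_frontier_cylinderAtom_eq_zero
    (h : SchrammSmirnov2011_lemma_5_1) (hD : IsOpen D) (hne : D.Nonempty)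
    (hμ : IsSubseqQuadLimit D μ) {ι : Type*} (s : Finset ι) (Q : ι → Quad D) (pos : ι → Bool) :
    (μ : Measure (QuadConfig D))
      (frontier (⋂ i ∈ s, if pos i then QuadConfig.crossedEvent (Q i)
        else (QuadConfig.crossedEvent (Q i))ᶜ)) = 0 := by
  refine measure_frontier_biInter_finset_eq_zero _ s fun i _ => ?_
  cases pos i
  · exact measure_frontier_compl_eq_zero _ (h D hD hne μ hμ (Q i))
  · exact h D hD hne μ hμ (Q i)

/-- **Every event of the Boolean algebra generated by finitely many crossing events is a
continuity event** (disjunctive normal form: a finite union, over `j ∈ t`, of atoms as in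
`measure_frontier_cylinderAtom_eq_zero`) — the hypothesis `μ₀(∂𝓜) = 0` of the portmanteau step in
Cor. 5.2; the convergence `μ_{δₖ}(𝓜) → μ(𝓜)` is then Mathlib's
`ProbabilityMeasure.tendsto_measure_of_null_frontier_of_tendsto` for probability laws on the
metrisable `ℋ_D`. [cite: SchrammSmirnov2011, Cor. 5.2] -/
theorem SchrammSmirnov2011_lemma_5_1.measure_frontier_dnf_eq_zero
    (h : SchrammSmirnov2011_lemma_5_1) (hD : IsOpen D) (hne : D.Nonempty)
    (hμ : IsSubseqQuadLimit D μ) {κ ι : Type*} (t : Finset κ) (s : κ → Finset ι)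
    (Q : κ → ι → Quad D) (pos : κ → ι → Bool) :
    (μ : Measure (QuadConfig D))
      (frontier (⋃ j ∈ t, ⋂ i ∈ s j, if pos j i then QuadConfig.crossedEvent (Q j i)
        else (QuadConfig.crossedEvent (Q j i))ᶜ)) = 0 :=
  measure_frontier_biUnion_finset_eq_zero _ t fun j _ =>
    h.measure_frontier_cylinderAtom_eq_zero hD hne hμ (s j) (Q j) (pos j)

end Consequences

end QuadCrossing

end Literature.Probability.Percolation

end
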